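import Mathlib
import Summits.NavierStokesRegularity.NavierStokesRegularity.Theorems.TaoLadderRungThreeRestartControlTools
import HarnessLib

/-!
# `RestartControl` tools II — the accumulated (4.10)-slack over the past epochs (helpers for item
  stmt-NavierStokesRegularity-20424, the shared support `RestartControl` of routes
  TaoLadderRungThree / TaoLadderRungTwo)

HONEST FRAMING: bookkeeping lemmas about Tao-type MODEL lattice pseudo-flows (Tao 2016, §6.4,
Lemma 6.7-type accounting of the cumulative energy integral over the past epochs) in the cell
vocabulary of the tree modules `LocalCascadeSolutions` / `RestartedCascadeFlows`. Nothing here is a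
statement about the Navier–Stokes equations and nothing is asserted about any particular table.

CONTENTS. Split `∫₀^{t_N} E_{i,N+k}` over the epochs `[t_{j−1}, t_j]`, `n₀ < j ≤ N`; on epoch `j` the
epoch envelope gives `E_{i,N+k} ≤ e_{j−1}² env(N+k−j+1)`, the lifespan bound gives length
`≤ c(1+ε₀)^{−5(j−1)/2}/e_{j−1}`, and `e_{j−1} ≤ (1+ε₀)^{θ(N−j+1)} e_N`; re-indexing `d = N − j + 1`
yields `restartSlack ≤ κ₂ · slackWeight (N − n₀) ≤ η · slackWeight (N − n₀)` (`restartSlack_le`).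
-/

noncomputable section

-- the sub-problem namespace `Summit.NavierStokesRegularity.NavierStokesRegularity` repeats the summit name by design (D-0017)
set_option linter.dupNamespace false

namespace Summit.NavierStokesRegularity.NavierStokesRegularity.Theorems

open Set MeasureTheory intervalIntegral Literature.Analysis.FluidPDE Literature.Analysis.FluidPDE.TaoCascade

namespace RestartControl

/-! ### The accumulated (4.10)-slack over the past epochs -/

section Slack

variable {ε₀ θ c : ℝ} {m : ℕ} {i₀ : Fin m} {n₀ : ℤ} {X₀ : Fin m → ℝ}
  {P : (Fin m → ℤ → ℝ) → (Fin m → ℤ → ℝ) → Prop} {env : ℤ → ℝ} {N : ℤ}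
  {X E : Fin m → ℤ → ℝ → ℝ} {t e : ℤ → ℝ} {T : ℝ}

/-- With at least one epoch, the envelope is nonnegative (energies are).
[cite: Tao2016AveragedNS, §6.2 Prop. 6.3 (ix)] -/
theorem env_nonneg (h : EpochCheckpoints ε₀ θ c i₀ n₀ X₀ P (epochEnvelope env) N X E t e)
    (hE0 : ∀ i n u, u ∈ Icc 0 T → 0 ≤ E i n u) (htT : t N ≤ T) (hN : n₀ < N) (k : ℤ) :
    0 ≤ env k := by
  have i₀' : Fin m := i₀
  have hs : t N ∈ Icc (t (N - 1)) (t N) := ⟨(h.mono N hN le_rfl).le, le_rfl⟩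
  have h1 := h.epoch N hN le_rfl (t N) hs i₀ k
  have heN := h.e_pos (N - 1) (by omega) (by omega)
  have htN : t N ∈ Icc 0 T := ⟨h.t_nonneg N hN.le le_rfl, htT⟩
  have h2 : 0 ≤ E i₀ (N - 1 + k) (t N) / e (N - 1) ^ 2 := div_nonneg (hE0 _ _ _ htN) (sq_nonneg _)
  exact h2.trans h1

/-- **One epoch**: on `[t_{n-1}, t_n]` the energy of shell `M = (n-1)+k'` integrates to at most
`c (1+ε₀)^{-5(n-1)/2} e_{n-1} env(k')` (envelope times lifespan).
[cite: Tao2016AveragedNS, §6.4 Lemma 6.7 (cumulative energy bound: one epoch)] -/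
theorem integral_epoch_le (h : EpochCheckpoints ε₀ θ c i₀ n₀ X₀ P (epochEnvelope env) N X E t e)
    (hE0 : ∀ i n u, u ∈ Icc 0 T → 0 ≤ E i n u) (htT : t N ≤ T) {n M k' : ℤ} (hn : n₀ < n)
    (hnN : n ≤ N) (hM : n - 1 + k' = M) (i : Fin m) :
    ∫ u in t (n - 1)..t n, E i M u ≤
      c * (1 + ε₀) ^ (-(5 : ℝ) * ((n : ℝ) - 1) / 2) * e (n - 1) * env k' := by
  have he := h.e_pos (n - 1) (by omega) (by omega)
  have hmono := h.mono n hn hnN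
  have hlife := h.life n hn hnN
  have ht0 : 0 ≤ t (n - 1) := h.t_nonneg (n - 1) (by omega) (by omega)
  have htn : t n ≤ T := (t_mono h.toShellCheckpoints (by omega) hnN le_rfl).trans htT
  have henv : ∀ s ∈ Icc (t (n - 1)) (t n), E i M s ≤ env k' * e (n - 1) ^ 2 := by
    intro s hs
    have h1 : E i (n - 1 + k') s / e (n - 1) ^ 2 ≤ env k' := h.epoch n hn hnN s hs i k'
    rw [hM] at h1
    rwa [div_le_iff₀ (pow_pos he 2)] at h1
  have hC : 0 ≤ env k' * e (n - 1) ^ 2 :=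
    (hE0 i M (t (n - 1)) ⟨ht0, hmono.le.trans htn⟩).trans (henv _ ⟨le_rfl, hmono.le⟩)
  have hbound : ∀ x ∈ Set.uIoc (t (n - 1)) (t n), ‖E i M x‖ ≤ env k' * e (n - 1) ^ 2 := by
    intro x hx
    rw [Set.uIoc_of_le hmono.le] at hx
    have hx' : x ∈ Icc (t (n - 1)) (t n) := Ioc_subset_Icc_self hx
    rw [Real.norm_eq_abs, abs_of_nonneg (hE0 i M x ⟨ht0.trans hx'.1, hx'.2.trans htn⟩)]
    exact henv x hx'
  have hint := intervalIntegral.norm_integral_le_of_norm_le_const hbound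
  rw [Real.norm_eq_abs, abs_of_pos (sub_pos.mpr hmono)] at hint
  calc ∫ u in t (n - 1)..t n, E i M u ≤ |∫ u in t (n - 1)..t n, E i M u| := le_abs_self _
    _ ≤ env k' * e (n - 1) ^ 2 * (t n - t (n - 1)) := hint
    _ ≤ env k' * e (n - 1) ^ 2 * (c * (1 + ε₀) ^ (-(5 : ℝ) * ((n : ℝ) - 1) / 2) * (e (n - 1))⁻¹) :=
        mul_le_mul_of_nonneg_left hlife hC
    _ = c * (1 + ε₀) ^ (-(5 : ℝ) * ((n : ℝ) - 1) / 2) * e (n - 1) * env k' := by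
        field_simp

/-- **All past epochs**: for `n₀ + J ≤ N`,
`∫₀^{t_{n₀+J}} E_{i,M} ≤ c ∑_{j<J} (1+ε₀)^{-5(n₀+j)/2} e_{n₀+j} env(M − n₀ − j)`.
[cite: Tao2016AveragedNS, §6.4 Lemma 6.7 (cumulative energy bound)] -/
theorem integral_le_sum_epochs (h : EpochCheckpoints ε₀ θ c i₀ n₀ X₀ P (epochEnvelope env) N X E t e)
    (hcont : ∀ i n, ContinuousOn (E i n) (Icc 0 T)) (hE0 : ∀ i n u, u ∈ Icc 0 T → 0 ≤ E i n u)
    (htT : t N ≤ T) (i : Fin m) (M : ℤ) :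
    ∀ J : ℕ, n₀ + J ≤ N →
      ∫ u in (0 : ℝ)..t (n₀ + J), E i M u ≤
        c * ∑ j ∈ Finset.range J,
          (1 + ε₀) ^ (-(5 : ℝ) * ((n₀ : ℝ) + j) / 2) * e (n₀ + j) * env (M - n₀ - j) := by
  intro J hJ
  induction J with
  | zero => simp [h.t_init]
  | succ J ih =>
      have hJ' : n₀ + (J : ℤ) ≤ N := by omega
      have ih' := ih hJ'
      -- interval integrability on `[0, t_{n₀+J}]` and on the epoch `[t_{n₀+J}, t_{n₀+J+1}]`
      have ht0 : ∀ n, n₀ ≤ n → n ≤ N → t n ∈ Icc 0 T := fun n hn hnN =>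
        ⟨h.t_nonneg n hn hnN, (t_mono h.toShellCheckpoints hn hnN le_rfl).trans htT⟩
      have hI1 : IntervalIntegrable (E i M) volume 0 (t (n₀ + J)) := by
        refine ((hcont i M).mono ?_).intervalIntegrable
        rw [Set.uIcc_of_le (ht0 _ (by omega) hJ').1]
        exact Icc_subset_Icc_right (ht0 _ (by omega) hJ').2
      have hI2 : IntervalIntegrable (E i M) volume (t (n₀ + J)) (t (n₀ + ((J + 1 : ℕ) : ℤ))) := by
        refine ((hcont i M).mono ?_).intervalIntegrable
        rw [Set.uIcc_of_le (t_mono h.toShellCheckpoints (by omega) (by omega) hJ)]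
        exact Icc_subset_Icc (ht0 _ (by omega) hJ').1 (ht0 _ (by omega) hJ).2
      rw [← intervalIntegral.integral_add_adjacent_intervals hI1 hI2, Finset.sum_range_succ, mul_add]
      refine add_le_add ih' ?_
      have hidx : (n₀ + ((J + 1 : ℕ) : ℤ)) - 1 = n₀ + (J : ℤ) := by push_cast; ring
      have hepoch := integral_epoch_le h hE0 htT (n := n₀ + ((J + 1 : ℕ) : ℤ)) (M := M)
        (k' := M - n₀ - J) (by omega) hJ (by omega) i
      rw [hidx] at hepoch
      have hcast : ((n₀ + ((J + 1 : ℕ) : ℤ) : ℤ) : ℝ) - 1 = (n₀ : ℝ) + (J : ℝ) := by push_cast; ring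
      rw [hcast] at hepoch
      exact hepoch.trans_eq (by ring)

/-- Re-indexing a finite sum from "epochs from the start" to "epochs from the end".
[folklore] -/
theorem sum_range_reflect_Icc (F : ℕ → ℝ) (L : ℕ) :
    ∑ j ∈ Finset.range L, F (L - j) = ∑ d ∈ Finset.Icc 1 L, F d := by
  induction L with
  | zero => simp
  | succ L ih =>
      rw [Finset.sum_range_succ', Finset.sum_Icc_succ_top (by omega), ← ih]
      simp only [Nat.sub_zero]
      congr 1
      exact Finset.sum_congr rfl fun j hj => by
        rw [Finset.mem_range] at hj
        congr 1
        omega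

/-- **The sum over the past epochs is at most `e_N (1+ε₀)^{-5N/2}` times the slack sum**:
using `e_{n₀+j} ≤ (1+ε₀)^{θ(N-n₀-j)} e_N`, `env ≥ 0`, and `d = N − n₀ − j`.
[cite: Tao2016AveragedNS, §6.4 Lemma 6.7 with §6.2 (6.12)] -/
theorem sum_epochs_le (h : ShellCheckpoints ε₀ θ c i₀ n₀ X₀ P N X E t e) (hε₀ : 0 < ε₀)
    (hN : n₀ ≤ N) (henv : ∀ k, 0 ≤ env k) (M : ℤ) :
    ∑ j ∈ Finset.range (N - n₀).toNat,
        (1 + ε₀) ^ (-(5 : ℝ) * ((n₀ : ℝ) + j) / 2) * e (n₀ + j) * env (M - n₀ - j) ≤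
      e N * (1 + ε₀) ^ (-(5 : ℝ) * N / 2) *
        ∑ d ∈ Finset.Icc 1 (N - n₀).toNat,
          (1 + ε₀) ^ ((5 / 2 + θ) * (d : ℝ)) * env (M - N + d) := by
  have hq : (0 : ℝ) < 1 + ε₀ := by linarith
  set L : ℕ := (N - n₀).toNat with hL
  have hLz : (L : ℤ) = N - n₀ := by rw [hL]; omega
  have hLr : (L : ℝ) = (N : ℝ) - n₀ := by exact_mod_cast hLz
  rw [← sum_range_reflect_Icc (fun d : ℕ => (1 + ε₀) ^ ((5 / 2 + θ) * (d : ℝ)) * env (M - N + d)) L,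
    Finset.mul_sum]
  refine Finset.sum_le_sum fun j hj => ?_
  rw [Finset.mem_range] at hj
  have hjL : ((L - j : ℕ) : ℝ) = (L : ℝ) - j := by
    rw [Nat.cast_sub hj.le]
  have hjLz : ((L - j : ℕ) : ℤ) = (L : ℤ) - j := by
    rw [Nat.cast_sub hj.le]
  have hidx : M - N + ((L - j : ℕ) : ℤ) = M - n₀ - j := by rw [hjLz, hLz]; ring
  rw [hidx]
  have he := e_le_rpow_mul h hq (n := n₀ + j) (by omega) (by omega)
  have henv' := henv (M - n₀ - j)
  have hpos1 : 0 < (1 + ε₀) ^ (-(5 : ℝ) * ((n₀ : ℝ) + j) / 2) := Real.rpow_pos_of_pos hq _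
  -- exponent identity
  have hexp : (1 + ε₀) ^ (-(5 : ℝ) * ((n₀ : ℝ) + j) / 2) * (1 + ε₀) ^ (θ * ((N : ℝ) - ((n₀ + j : ℤ) : ℝ))) =
      (1 + ε₀) ^ (-(5 : ℝ) * N / 2) * (1 + ε₀) ^ ((5 / 2 + θ) * (((L - j : ℕ) : ℝ))) := by
    rw [← Real.rpow_add hq, ← Real.rpow_add hq, hjL, hLr]
    congr 1
    push_cast
    ring
  calc (1 + ε₀) ^ (-(5 : ℝ) * ((n₀ : ℝ) + j) / 2) * e (n₀ + j) * env (M - n₀ - j)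
      ≤ (1 + ε₀) ^ (-(5 : ℝ) * ((n₀ : ℝ) + j) / 2) *
          ((1 + ε₀) ^ (θ * ((N : ℝ) - ((n₀ + j : ℤ) : ℝ))) * e N) * env (M - n₀ - j) := by
        gcongr
    _ = e N * (1 + ε₀) ^ (-(5 : ℝ) * N / 2) *
          ((1 + ε₀) ^ ((5 / 2 + θ) * (((L - j : ℕ) : ℝ))) * env (M - n₀ - j)) := by
        rw [show ∀ A B C D : ℝ, A * (B * C) * D = C * (A * B) * D from fun A B C D => by ring, hexp]
        ring

/-- **The restarted slack is admissible**: `0 ≤ restartSlack ≤ κ₂ · slackWeight (N − n₀)` with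
`κ₂ = K₂ e_N⁻¹ (1+ε₀)^{-N/2}`. [cite: Tao2016AveragedNS, §6.4 Lemma 6.7 with §4 (4.10)] -/
theorem restartSlack_le (h : EpochCheckpoints ε₀ θ c i₀ n₀ X₀ P (epochEnvelope env) N X E t e)
    (hε₀ : 0 < ε₀) (hc : 0 ≤ c) (hN : n₀ ≤ N) {K₂ η : ℝ} (hK₂ : 0 ≤ K₂)
    (hκ : K₂ / (e N * (1 + ε₀) ^ ((N : ℝ) / 2)) ≤ η)
    (hcont : ∀ i n, ContinuousOn (E i n) (Icc 0 T)) (hE0 : ∀ i n u, u ∈ Icc 0 T → 0 ≤ E i n u)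
    (htT : t N ≤ T) (i : Fin m) (k : ℤ) :
    0 ≤ restartSlack ε₀ K₂ N (t N) (e N) E i k ∧
      restartSlack ε₀ K₂ N (t N) (e N) E i k ≤ η * slackWeight ε₀ θ c env (N - n₀).toNat k := by
  have hq : (0 : ℝ) < 1 + ε₀ := by linarith
  have heN : 0 < e N := h.e_pos N hN le_rfl
  have htN : t N ∈ Icc 0 T := ⟨h.t_nonneg N hN le_rfl, htT⟩
  have hint0 : 0 ≤ ∫ u in (0 : ℝ)..t N, E i (N + k) u :=
    intervalIntegral.integral_nonneg htN.1 fun u hu => hE0 i (N + k) u ⟨hu.1, hu.2.trans htT⟩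
  have hpow2 : 0 < (1 + ε₀) ^ ((2 : ℝ) * ((N : ℝ) + k)) := Real.rpow_pos_of_pos hq _
  constructor
  · unfold restartSlack
    exact div_nonneg (mul_nonneg (mul_nonneg hK₂ hpow2.le) hint0) (sq_nonneg _)
  · -- the integral bound
    set L : ℕ := (N - n₀).toNat with hL
    have hNL : n₀ + (L : ℤ) = N := by rw [hL]; omega
    have hI := integral_le_sum_epochs h hcont hE0 htT i (N + k) L hNL.le
    rw [hNL] at hI
    -- envelope nonnegativity (vacuous sum when `N = n₀`)
    have hsum : ∑ j ∈ Finset.range L,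
          (1 + ε₀) ^ (-(5 : ℝ) * ((n₀ : ℝ) + j) / 2) * e (n₀ + j) * env (N + k - n₀ - j) ≤
        e N * (1 + ε₀) ^ (-(5 : ℝ) * N / 2) *
          ∑ d ∈ Finset.Icc 1 L, (1 + ε₀) ^ ((5 / 2 + θ) * (d : ℝ)) * env (N + k - N + d) := by
      rcases eq_or_lt_of_le hN with hNn | hNn
      · -- no epochs: both sums are empty
        have hL0 : L = 0 := by rw [hL, ← hNn]; simp
        simp [hL0]
      · exact sum_epochs_le h.toShellCheckpoints hε₀ hN (env_nonneg h hE0 htT hNn) (N + k)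
    have hslack : ∑ d ∈ Finset.Icc 1 L, (1 + ε₀) ^ ((5 / 2 + θ) * (d : ℝ)) * env (N + k - N + d) =
        ∑ d ∈ Finset.Icc 1 L, (1 + ε₀) ^ ((5 / 2 + θ) * (d : ℝ)) * env (k + d) := by
      refine Finset.sum_congr rfl fun d _ => ?_
      rw [show N + k - N + (d : ℤ) = k + d by ring]
    rw [hslack] at hsum
    have hS0 : 0 ≤ ∑ d ∈ Finset.Icc 1 L, (1 + ε₀) ^ ((5 / 2 + θ) * (d : ℝ)) * env (k + d) := by
      rcases eq_or_lt_of_le hN with hNn | hNn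
      · have hL0 : L = 0 := by rw [hL, ← hNn]; simp
        simp [hL0]
      · exact Finset.sum_nonneg fun d _ =>
          mul_nonneg (Real.rpow_pos_of_pos hq _).le (env_nonneg h hE0 htT hNn _)
    -- assemble
    have hsw0 : 0 ≤ slackWeight ε₀ θ c env L k := by
      unfold slackWeight
      exact mul_nonneg (mul_nonneg hc (Real.rpow_pos_of_pos hq _).le) hS0
    unfold restartSlack
    have hsplit : (1 + ε₀) ^ ((2 : ℝ) * ((N : ℝ) + k)) * (1 + ε₀) ^ (-(5 : ℝ) * N / 2) =
        (1 + ε₀) ^ ((2 : ℝ) * k) / (1 + ε₀) ^ ((N : ℝ) / 2) := by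
      rw [eq_div_iff (Real.rpow_pos_of_pos hq _).ne', ← Real.rpow_add hq, ← Real.rpow_add hq]
      congr 1
      ring
    have hmain : K₂ * (1 + ε₀) ^ ((2 : ℝ) * ((N : ℝ) + k)) * (∫ u in (0 : ℝ)..t N, E i (N + k) u) ≤
        K₂ * (1 + ε₀) ^ ((2 : ℝ) * ((N : ℝ) + k)) * (c * (e N * (1 + ε₀) ^ (-(5 : ℝ) * N / 2) *
          ∑ d ∈ Finset.Icc 1 L, (1 + ε₀) ^ ((5 / 2 + θ) * (d : ℝ)) * env (k + d))) :=
      mul_le_mul_of_nonneg_left (hI.trans (mul_le_mul_of_nonneg_left hsum hc))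
        (mul_nonneg hK₂ hpow2.le)
    calc K₂ * (1 + ε₀) ^ ((2 : ℝ) * ((N : ℝ) + k)) * (∫ u in (0 : ℝ)..t N, E i (N + k) u) / e N ^ 2
        ≤ K₂ * (1 + ε₀) ^ ((2 : ℝ) * ((N : ℝ) + k)) * (c * (e N * (1 + ε₀) ^ (-(5 : ℝ) * N / 2) *
            ∑ d ∈ Finset.Icc 1 L, (1 + ε₀) ^ ((5 / 2 + θ) * (d : ℝ)) * env (k + d))) / e N ^ 2 :=
          div_le_div_of_nonneg_right hmain (sq_nonneg _)
      _ = K₂ / (e N * (1 + ε₀) ^ ((N : ℝ) / 2)) * slackWeight ε₀ θ c env L k := by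
          unfold slackWeight
          rw [show ∀ A I S : ℝ, K₂ * A * (c * (e N * I * S)) / e N ^ 2 =
              K₂ * (A * I) * c * S * e N / e N ^ 2 from fun A I S => by ring, hsplit]
          field_simp
      _ ≤ η * slackWeight ε₀ θ c env L k := mul_le_mul_of_nonneg_right hκ hsw0

end Slack

end RestartControl

end Summit.NavierStokesRegularity.NavierStokesRegularity.Theorems

end
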